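import Summits.ValiantsHypothesis.ValiantsHypothesis.Theorems.FreeSubtorusOrbitDimensionBoundStubPolystableModelClosed
import Summits.ValiantsHypothesis.ValiantsHypothesis.Theorems.FreeSubtorusOrbitDimensionBoundStubPolystableModelGraded
import Literature.Computability.AlgebraicComplexity.StandardFamiliesProofs

/-!
# `OrbitDimensionBound` (stmt-ValiantsHypothesis-16133), rung line `filtered_covering` — stub `stub_polystableModel`,
# part 6: the registered stub (Jordan–Hölder existence; the polystable model)

Last file for stub 1 `stub_polystableModel` of `Cruxes/OrbitDimensionBound/Lines/filtered_covering.lean` (route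
`FreeSubtorus`, rung `Depth.FilteredShadow`).  Assembling parts 1–5 (`…PolystableModelComplement`, `…Levels`, `…Closed`,
`…BlockSum`, `…Graded`):

* `complemented_baseChange` — "every balanced sub-pencil is complemented" is invariant under constant gauge `X ↦ P X Q`;
* **`stub_polystableModel`** — the registered stub `Depth.Line.Stmt.stub_polystableModel` with the workfile definitions
  `IsDegeneration` / `weightTruncate` / `IsDegenerationClosed` UNFOLDED (`weightTruncate a b X` is
  `Matrix.of fun i j => if a i = b j then X i j else 0`): every affine determinantal representation `A` of `per_n` has a
  one-parameter degeneration `P` which is again an affine determinantal representation of `per_n` and whose constant gauge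
  orbit is closed under one-parameter degeneration.  Proof: `exists_semisimple_degeneration` (part 5) gives a gauge form
  `P₁ A Q₁` and weights whose truncation is SEMISIMPLE; rescale one row to get `det = per_n` exactly; semisimple ⇒
  complemented (part 1) ⇒ every degeneration of it is a gauge form (part 3, after gauge transport).

Helper mode (`--supports stmt-ValiantsHypothesis-16133 --as helper`).  Honest framing: [folklore] linear algebra closing
ONE registered stub (`stub_polystableModel`, L) of a dormant rung line whose hardest stub `stub_jordanHolder` (transport
of the polystable model along common degenerations) remains OPEN; the rung `FilteredShadow`, the crux `OrbitDimensionBound`,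
the route `FreeSubtorus` and VP ≠ VNP are OPEN and are not moved by this file.

## References (orientation only)
* A. D. King, Quart. J. Math. 45 (1994), Prop. 3.1, Thm. 4.1.  * G. Kempf, L. Ness (1979).
-/

set_option linter.dupNamespace false

namespace Summit.ValiantsHypothesis.ValiantsHypothesis.Theorems.FreeSubtorusOrbitDimensionBound.SquareCovering.StableReduction

open Matrix MvPolynomial Module
open Literature.Computability.AlgebraicComplexity
open Summit.ValiantsHypothesis.ValiantsHypothesis.Theorems.FreeSubtorusOrbitDimensionBound.SquareCovering
open Summit.ValiantsHypothesis.ValiantsHypothesis.Theorems.FreeSubtorusOrbitDimensionBound.SignCovering.PerSummand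

/-! ### §1 Complementedness is gauge invariant -/

section Transport

variable {σ : Type*} {m : ℕ}

/-- **Complementedness is invariant under constant gauge.**  If every balanced sub-pencil of `X` has a balanced
complement, the same holds for `P X Q` (`P, Q ∈ GL_m(ℂ)`): `U` is balanced for `P X Q` iff `Q U` is balanced for `X`.
[folklore] -/
theorem complemented_baseChange (X : Matrix (Fin m) (Fin m) (MvPolynomial σ ℂ)) (P Q : GL (Fin m) ℂ)
    (hcompl : ∀ U : Submodule ℂ (Fin m → ℂ),
      finrank ℂ ↥(⨆ e : σ →₀ ℕ, U.map (Matrix.toLin' (X.map (coeff e)))) ≤ finrank ℂ U →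
      ∃ C : Submodule ℂ (Fin m → ℂ), finrank ℂ ↥(⨆ e : σ →₀ ℕ, C.map (Matrix.toLin' (X.map (coeff e)))) ≤ finrank ℂ C ∧
        U ⊓ C = ⊥ ∧ U ⊔ C = ⊤) :
    ∀ U : Submodule ℂ (Fin m → ℂ),
      finrank ℂ ↥(⨆ e : σ →₀ ℕ, U.map (Matrix.toLin' (((P : Matrix (Fin m) (Fin m) ℂ).map C * X *
        (Q : Matrix (Fin m) (Fin m) ℂ).map C).map (coeff e)))) ≤ finrank ℂ U →
      ∃ C' : Submodule ℂ (Fin m → ℂ),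
        finrank ℂ ↥(⨆ e : σ →₀ ℕ, C'.map (Matrix.toLin' (((P : Matrix (Fin m) (Fin m) ℂ).map C * X *
          (Q : Matrix (Fin m) (Fin m) ℂ).map C).map (coeff e)))) ≤ finrank ℂ C' ∧
        U ⊓ C' = ⊥ ∧ U ⊔ C' = ⊤ := by
  -- `W_{PXQ}(U) = P · W_X(Q U)`
  have hW : ∀ U : Submodule ℂ (Fin m → ℂ), (⨆ e : σ →₀ ℕ, U.map (Matrix.toLin' (((P : Matrix (Fin m) (Fin m) ℂ).map C *
      X * (Q : Matrix (Fin m) (Fin m) ℂ).map C).map (coeff e)))) =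
      (⨆ e : σ →₀ ℕ, (U.map (Matrix.toLin' (Q : Matrix (Fin m) (Fin m) ℂ))).map (Matrix.toLin' (X.map (coeff e)))).map
        (Matrix.toLin' (P : Matrix (Fin m) (Fin m) ℂ)) := by
    intro U
    rw [Submodule.map_iSup]
    refine iSup_congr fun e => ?_
    rw [map_coeff_mul_map_C, map_coeff_map_C_mul, Matrix.toLin'_mul, Matrix.toLin'_mul, Submodule.map_comp,
      Submodule.map_comp]
  have hQinj : Function.Injective (Matrix.toLin' (Q : Matrix (Fin m) (Fin m) ℂ)) := by
    rw [← LinearMap.ker_eq_bot, Matrix.ker_toLin'_eq_bot_iff]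
    intro v hv
    have := congrArg (fun w => ((Q⁻¹ : GL (Fin m) ℂ) : Matrix (Fin m) (Fin m) ℂ) *ᵥ w) hv
    simpa only [Matrix.mulVec_mulVec, ← Units.val_mul, inv_mul_cancel, Units.val_one, Matrix.one_mulVec,
      Matrix.mulVec_zero] using this
  have hQ'inj : Function.Injective (Matrix.toLin' ((Q⁻¹ : GL (Fin m) ℂ) : Matrix (Fin m) (Fin m) ℂ)) := by
    rw [← LinearMap.ker_eq_bot, Matrix.ker_toLin'_eq_bot_iff]
    intro v hv
    have := congrArg (fun w => ((Q : GL (Fin m) ℂ) : Matrix (Fin m) (Fin m) ℂ) *ᵥ w) hv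
    simpa only [Matrix.mulVec_mulVec, ← Units.val_mul, mul_inv_cancel, Units.val_one, Matrix.one_mulVec,
      Matrix.mulVec_zero] using this
  have hPinj : Function.Injective (Matrix.toLin' (P : Matrix (Fin m) (Fin m) ℂ)) := by
    rw [← LinearMap.ker_eq_bot, Matrix.ker_toLin'_eq_bot_iff]
    intro v hv
    have := congrArg (fun w => ((P⁻¹ : GL (Fin m) ℂ) : Matrix (Fin m) (Fin m) ℂ) *ᵥ w) hv
    simpa only [Matrix.mulVec_mulVec, ← Units.val_mul, inv_mul_cancel, Units.val_one, Matrix.one_mulVec,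
      Matrix.mulVec_zero] using this
  have hfin : ∀ (f : (Fin m → ℂ) →ₗ[ℂ] (Fin m → ℂ)), Function.Injective f → ∀ U : Submodule ℂ (Fin m → ℂ),
      finrank ℂ ↥(U.map f) = finrank ℂ U := fun f hf U =>
    LinearEquiv.finrank_eq (Submodule.equivMapOfInjective f hf U).symm
  have hQQ' : ∀ U : Submodule ℂ (Fin m → ℂ), (U.map (Matrix.toLin' ((Q⁻¹ : GL (Fin m) ℂ) : Matrix (Fin m) (Fin m) ℂ))).map
      (Matrix.toLin' (Q : Matrix (Fin m) (Fin m) ℂ)) = U := fun U => by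
    rw [← Submodule.map_comp, ← Matrix.toLin'_mul, ← Units.val_mul, mul_inv_cancel, Units.val_one, Matrix.toLin'_one,
      Submodule.map_id]
  have hQ'Q : ∀ U : Submodule ℂ (Fin m → ℂ), (U.map (Matrix.toLin' (Q : Matrix (Fin m) (Fin m) ℂ))).map
      (Matrix.toLin' ((Q⁻¹ : GL (Fin m) ℂ) : Matrix (Fin m) (Fin m) ℂ)) = U := fun U => by
    rw [← Submodule.map_comp, ← Matrix.toLin'_mul, ← Units.val_mul, inv_mul_cancel, Units.val_one, Matrix.toLin'_one,
      Submodule.map_id]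
  intro U hU
  rw [hW, hfin _ hPinj] at hU
  rw [← hfin _ hQinj U] at hU
  obtain ⟨C, hCbal, hCinf, hCsup⟩ := hcompl _ hU
  refine ⟨C.map (Matrix.toLin' ((Q⁻¹ : GL (Fin m) ℂ) : Matrix (Fin m) (Fin m) ℂ)), ?_, ?_, ?_⟩
  · rw [hW, hfin _ hPinj, hQQ', hfin _ hQ'inj]; exact hCbal
  · rw [← hQ'Q U, ← Submodule.map_inf _ hQ'inj, hCinf, Submodule.map_bot]
  · rw [← hQ'Q U, ← Submodule.map_sup, hCsup, Submodule.map_top, LinearMap.range_eq_top]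
    exact LinearMap.surjective_of_injective hQ'inj

end Transport

/-! ### §2 The registered stub -/

section Stub

/-- A vector of non-zero scalars with prescribed product (`m ≥ 1`, or `m = 0` and the product is `1`). [folklore] -/
theorem exists_prod_eq {m : ℕ} (c : ℂ) (hc : c ≠ 0) (h0 : m = 0 → c = 1) :
    ∃ D : Fin m → ℂ, (∀ i, D i ≠ 0) ∧ ∏ i, D i = c := by
  classical
  rcases Nat.eq_zero_or_pos m with hm | hm
  · subst hm
    exact ⟨fun i => Fin.elim0 i, fun i => Fin.elim0 i, by rw [Finset.univ_eq_empty, Finset.prod_empty, h0 rfl]⟩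
  · refine ⟨Function.update (fun _ => (1 : ℂ)) ⟨0, hm⟩ c, fun i => ?_, ?_⟩
    · by_cases hi : i = ⟨0, hm⟩
      · subst hi; rw [Function.update_self]; exact hc
      · rw [Function.update_of_ne hi]; exact one_ne_zero
    · rw [Finset.prod_update_of_mem (Finset.mem_univ _)]
      simp

/-- **Stub 1 `stub_polystableModel` of the line `filtered_covering`** (`Depth.Line.Stmt.stub_polystableModel` with
`IsDegeneration`, `weightTruncate`, `IsDegenerationClosed` unfolded): every affine determinantal representation `A` of
`per_n` has a one-parameter degeneration `P` (any depth) which is again an affine determinantal representation of `per_n`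
and whose constant gauge orbit is closed under one-parameter degeneration (the POLYSTABLE MODEL `gr_JH(A)`).
[cite: LandsbergRessayre2017, §3, §6] -/
theorem stub_polystableModel :
    ∀ (n m : ℕ) (A : Matrix (Fin m) (Fin m) (MvPolynomial (Fin n × Fin n) ℂ)),
      IsAffineDetRepr (perPoly (Fin n) ℂ) A →
      ∃ P : Matrix (Fin m) (Fin m) (MvPolynomial (Fin n × Fin n) ℂ),
        (∃ (P' Q' : GL (Fin m) ℂ) (a b : Fin m → ℕ),
          (∀ i, (a i : ℕ∞) ≤ ⊤) ∧ (∀ j, (b j : ℕ∞) ≤ ⊤) ∧ ∑ i, a i = ∑ j, b j ∧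
          (∀ i j, a i < b j →
            ((P' : Matrix (Fin m) (Fin m) ℂ).map C * A * (Q' : Matrix (Fin m) (Fin m) ℂ).map C :
              Matrix (Fin m) (Fin m) (MvPolynomial (Fin n × Fin n) ℂ)) i j = 0) ∧
          P = Matrix.of fun i j => if a i = b j then
            ((P' : Matrix (Fin m) (Fin m) ℂ).map C * A * (Q' : Matrix (Fin m) (Fin m) ℂ).map C :
              Matrix (Fin m) (Fin m) (MvPolynomial (Fin n × Fin n) ℂ)) i j else 0) ∧
        IsAffineDetRepr (perPoly (Fin n) ℂ) P ∧
        ∀ B : Matrix (Fin m) (Fin m) (MvPolynomial (Fin n × Fin n) ℂ),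
          (∃ (P' Q' : GL (Fin m) ℂ) (a b : Fin m → ℕ),
            (∀ i, (a i : ℕ∞) ≤ ⊤) ∧ (∀ j, (b j : ℕ∞) ≤ ⊤) ∧ ∑ i, a i = ∑ j, b j ∧
            (∀ i j, a i < b j →
              ((P' : Matrix (Fin m) (Fin m) ℂ).map C * P * (Q' : Matrix (Fin m) (Fin m) ℂ).map C :
                Matrix (Fin m) (Fin m) (MvPolynomial (Fin n × Fin n) ℂ)) i j = 0) ∧
            B = Matrix.of fun i j => if a i = b j then
              ((P' : Matrix (Fin m) (Fin m) ℂ).map C * P * (Q' : Matrix (Fin m) (Fin m) ℂ).map C :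
                Matrix (Fin m) (Fin m) (MvPolynomial (Fin n × Fin n) ℂ)) i j else 0) →
          ∃ (P' Q' : GL (Fin m) ℂ) (a b : Fin m → ℕ),
            (∀ i, (a i : ℕ∞) ≤ 0) ∧ (∀ j, (b j : ℕ∞) ≤ 0) ∧ ∑ i, a i = ∑ j, b j ∧
            (∀ i j, a i < b j →
              ((P' : Matrix (Fin m) (Fin m) ℂ).map C * P * (Q' : Matrix (Fin m) (Fin m) ℂ).map C :
                Matrix (Fin m) (Fin m) (MvPolynomial (Fin n × Fin n) ℂ)) i j = 0) ∧
            B = Matrix.of fun i j => if a i = b j then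
              ((P' : Matrix (Fin m) (Fin m) ℂ).map C * P * (Q' : Matrix (Fin m) (Fin m) ℂ).map C :
                Matrix (Fin m) (Fin m) (MvPolynomial (Fin n × Fin n) ℂ)) i j else 0 := by
  intro n m A hA
  classical
  have hdet : A.det ≠ 0 := by rw [hA.2]; exact perPoly_ne_zero (Fin n) ℂ
  obtain ⟨P₁, Q₁, a, b, hs, hz, T, hT, hTtop⟩ := exists_semisimple_degeneration m A hdet
  set X : Matrix (Fin m) (Fin m) (MvPolynomial (Fin n × Fin n) ℂ) :=
    (P₁ : Matrix (Fin m) (Fin m) ℂ).map C * A * (Q₁ : Matrix (Fin m) (Fin m) ℂ).map C with hX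
  -- the row rescaling `D` with `det D · det P₁ · det Q₁ = 1`
  set u : ℂ := (P₁ : Matrix (Fin m) (Fin m) ℂ).det * (Q₁ : Matrix (Fin m) (Fin m) ℂ).det with hu
  have hu0 : u ≠ 0 := mul_ne_zero (Matrix.isUnits_det_units P₁).ne_zero (Matrix.isUnits_det_units Q₁).ne_zero
  obtain ⟨D, hD0, hDprod⟩ := exists_prod_eq (m := m) u⁻¹ (inv_ne_zero hu0) fun hm => by
    subst hm; rw [hu, Matrix.det_isEmpty, Matrix.det_isEmpty, mul_one, inv_one]
  have hDdet : (Matrix.diagonal D).det ≠ 0 := by rw [Matrix.det_diagonal]; exact Finset.prod_ne_zero_iff.2 fun i _ => hD0 i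
  set Du : GL (Fin m) ℂ := Matrix.GeneralLinearGroup.mkOfDetNeZero _ hDdet with hDu
  -- the model
  set P₀ : Matrix (Fin m) (Fin m) (MvPolynomial (Fin n × Fin n) ℂ) := Matrix.of fun i j => if a i = b j then X i j else 0
    with hP₀
  have hDX : ∀ i j, (((Du * P₁ : GL (Fin m) ℂ) : Matrix (Fin m) (Fin m) ℂ).map C * A * (Q₁ : Matrix (Fin m) (Fin m) ℂ).map C :
      Matrix (Fin m) (Fin m) (MvPolynomial (Fin n × Fin n) ℂ)) i j = C (D i) * X i j := by
    intro i j
    rw [Units.val_mul, Matrix.map_mul, Matrix.mul_assoc, Matrix.mul_assoc, ← Matrix.mul_assoc _ A, ← hX, hDu,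
      Matrix.GeneralLinearGroup.val_mkOfDetNeZero, Matrix.diagonal_map (map_zero C), Matrix.diagonal_mul]
  have hDP₀ : ((Du : Matrix (Fin m) (Fin m) ℂ).map C * P₀ : Matrix (Fin m) (Fin m) (MvPolynomial (Fin n × Fin n) ℂ)) =
      Matrix.of fun i j => if a i = b j then
        (((Du * P₁ : GL (Fin m) ℂ) : Matrix (Fin m) (Fin m) ℂ).map C * A * (Q₁ : Matrix (Fin m) (Fin m) ℂ).map C :
          Matrix (Fin m) (Fin m) (MvPolynomial (Fin n × Fin n) ℂ)) i j else 0 := by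
    ext i j
    rw [hDu, Matrix.GeneralLinearGroup.val_mkOfDetNeZero, Matrix.diagonal_map (map_zero C), Matrix.diagonal_mul,
      Matrix.of_apply, ← hDu, hDX, hP₀, Matrix.of_apply]
    split_ifs <;> simp
  -- semisimple ⇒ complemented, transported to the rescaled model
  have hcomplP₀ := fun (U : Submodule ℂ (Fin m → ℂ))
      (hU : finrank ℂ ↥(⨆ e : (Fin n × Fin n) →₀ ℕ, U.map (Matrix.toLin' (P₀.map (coeff e)))) ≤ finrank ℂ U) =>
    exists_balanced_compl_of_finsetSup_eq_top (fun e : (Fin n × Fin n) →₀ ℕ => Matrix.toLin' (P₀.map (coeff e))) (by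
      intro V
      by_contra hlt
      have hP₀det : P₀.det ≠ 0 := by
        rw [hP₀, det_truncate a b X hs hz, hX, det_map_C_mul_mul_map_C]
        exact mul_ne_zero (by rw [Ne, C_eq_zero]; exact hu0) hdet
      refine hP₀det (det_eq_zero_of_subpencil P₀ V _ (fun e x hx => ?_) (not_le.1 hlt))
      exact Submodule.mem_iSup_of_mem e (Submodule.mem_map_of_mem hx)) T hT hTtop hU
  have hcompl := complemented_baseChange P₀ Du 1 hcomplP₀
  rw [Units.val_one, Matrix.map_one C C_0 C_1, Matrix.mul_one] at hcompl
  refine ⟨(Du : Matrix (Fin m) (Fin m) ℂ).map C * P₀, ⟨Du * P₁, Q₁, a, b, fun _ => le_top, fun _ => le_top, hs,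
    fun i j hij => by rw [hDX, hz i j hij, mul_zero], hDP₀⟩, ⟨?_, ?_⟩, ?_⟩
  · -- affine
    intro i j
    rw [hDP₀, Matrix.of_apply]
    split_ifs
    · exact totalDegree_map_C_mul_mul_map_C_le _ _ hA.1 _ _
    · simp
  · -- `det = per_n`
    rw [hDP₀, det_truncate a b _ hs (fun i j hij => by rw [hDX, hz i j hij, mul_zero]), det_map_C_mul_mul_map_C, hA.2,
      Units.val_mul, Matrix.det_mul, hDu, Matrix.GeneralLinearGroup.val_mkOfDetNeZero, Matrix.det_diagonal, hDprod,
      mul_assoc, ← hu, inv_mul_cancel₀ hu0, C_1, one_mul]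
  · -- degeneration-closed
    rintro B ⟨P', Q', a', b', -, -, hs', hz', rfl⟩
    have hcompl' := complemented_baseChange _ P' Q' hcompl
    have hdet'' : ((P' : Matrix (Fin m) (Fin m) ℂ).map C * ((Du : Matrix (Fin m) (Fin m) ℂ).map C * P₀) *
        (Q' : Matrix (Fin m) (Fin m) ℂ).map C : Matrix (Fin m) (Fin m) (MvPolynomial (Fin n × Fin n) ℂ)).det ≠ 0 := by
      rw [det_map_C_mul_mul_map_C, Matrix.det_mul, det_map_C, hP₀, det_truncate a b X hs hz, hX, det_map_C_mul_mul_map_C]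
      refine mul_ne_zero ?_ (mul_ne_zero ?_ (mul_ne_zero ?_ hdet))
      · rw [Ne, C_eq_zero]
        exact mul_ne_zero (Matrix.isUnits_det_units P').ne_zero (Matrix.isUnits_det_units Q').ne_zero
      · rw [Ne, C_eq_zero, hDu, Matrix.GeneralLinearGroup.val_mkOfDetNeZero]; exact hDdet
      · rw [Ne, C_eq_zero]; exact hu0
    obtain ⟨S, T', hST⟩ := truncate_eq_baseChange_of_complemented _ hdet'' hcompl' a' b' hz' hs'
    refine ⟨S * P', Q' * T', fun _ => 0, fun _ => 0, fun _ => le_rfl, fun _ => le_rfl, rfl,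
      fun i j hij => (lt_irrefl _ hij).elim, ?_⟩
    rw [hST]
    ext i j
    simp only [Matrix.of_apply, if_true, Units.val_mul, Matrix.map_mul, Matrix.mul_assoc]

end Stub

end Summit.ValiantsHypothesis.ValiantsHypothesis.Theorems.FreeSubtorusOrbitDimensionBound.SquareCovering.StableReduction
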